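import Summits.QuantumFields.YangMills.Theorems.UnitScaleTiltProp8FlatPortColumnLetterL0
import Summits.QuantumFields.YangMills.Theorems.UnitScaleTiltProp8FlatPortKernelRowsAllL
import HarnessLib

/-!
# Route `UnitScaleTilt`, crux K1 child «MinimiserStabilityRegPr» (stmt-QuantumFields-19200), v8 pillar P2 — port level, **THE (X2-H) COLUMN LETTERS OF `flatH`,
# EVERY ODD `L ≥ 3`**: the twin of ✓`UnitScaleTiltProp8FlatPortColumnLetterL0` (`kernelRow1_colSum_domT`, `columnInputs_of_adm22`, `flatH_column_of_adm22`,
# `flatHs_column_of_adm22`) with the block-size floor `(hℓ : 4 ≤ ℓ)` DELETED, reading Cor. 2.8 (2.151)₁,₂ through ✓`FlatPortCor28PadAllL.cor28_kLevel_H_DH_pad_allL` (lit-balaban's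
# `B6Cor28EntriesKLevelV1L3`) and the recharting through ✓`FlatPortKernelRowsAllL.chart_params_allL`

Cell `ym3-torus` (HUMAN RULING D-0037, YM ladder rung R3), seat `ym-inputs-p09` (cell `pub/ym-inputs`, on-call hand; ★★OWNER RULING g26-№20 L-FLOOR LEDGER item LF-1 ∕
(P2-L3); LEAD ★w5-19200 g4 board 09:30Z).  `--supports stmt-QuantumFields-19200 --as helper`; count-neutral; def-free.

WHAT IS PROVED (sorry-free; axioms standard; no definition): **`kernelRow1_colSum_domT_allL`**, **`columnInputs_of_adm22_allL`**, **`flatH_column_of_adm22_allL`**,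
**`flatHs_column_of_adm22_allL`** — the statements of the L0 file VERBATIM minus the binder `(hℓ : 4 ≤ ℓ)`, at every charted ∕ every `Adm22` family, EVERY odd `L ≥ 3`.
Proof = the L0 proof verbatim (helpers `blkOf_toBox_eq_of_block`, `l1_column_of_kernel`, `smul_column_of_kernel`, `hRows12_of_cor28Shape`, `colSum_domT`, `globalBand_unitWeights`,
`unitWeights_pos`, `theta_budget` consumed BY NAME).
HONEST SCOPE: bookkeeping over lit-balaban's kernel-checked L3 chain (`…V1L3`, binder `4 ≤ ℓ` dropped) through the `_allL` pads; the torus-size binder `a′ + 3 ≤ m + n`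
stays ((P2-small), cured by the (α) cover); constants crude (L3 coercivity `γ₀ = (1/12)²/C_E` where it enters); nothing here proves `stub_halvingStep` or the crux;
YM₃ on T³ = rung R3, NOT the Clay problem, no mass-gap claim.

References: T. Bałaban, CMP **96** (1984) 223–250 [Balaban1984PropagatorsII] Cor. 2.8 (2.150)–(2.151) p.249, Lemma 2.1 (2.60)–(2.61) p.234; CMP **102** (1985) 277–309
[Balaban1985Variational] (157)–(158) p.302, (161)–(163) p.303.
-/

set_option autoImplicit false

noncomputable section

open scoped BigOperators

namespace Summit.QuantumFields.YangMills.Theorems.FlatPortColumnLetterAllL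

open FlatPortColumnLetterL0 (blkOf_toBox_eq_of_block l1_column_of_kernel smul_column_of_kernel)

open FlatPortKernelRows (theta_budget)
open FlatPortKernelRowsAllL (chart_params_allL)
open Literature.MathematicalPhysics.QuantumFieldTheory.Balaban1983to89
open B4Reflection242 (boxDom blk)
open B5Eq118OneStroke (iterBlockOf)
open B6MultiLevelBoxOperator (N0)
open B6MultiLevelTorusOperatorL0 (TDomains)
open B6Geom246MultiLevelBoxL0 (bset blkOf blkOf_val)
open B6Geom246MultiLevelTorusL0 (geomT bondT)
open B6GlobalChartV1 (PV toBox blk_toBox)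
open B6GlobalChartV1L0 (blkV1 domT)
open B6Ineq2142KLevelV1L0 (β)
open B6Ineq261LevelGap (K261 K261_nonneg)
open B6Cor28KLevelV1 (two_le_RMh)
open B6CubeWindowV1 (GlobalBand)
open B6SectAOperatorsV1 (BondIdx SiteIdx)
open B11Eq115Space (levOf)
open T3ContinuumYM3Torus (T3Family)
open FlatCubeOpsText (IsLevWeight)
open FlatOpsLettersAssembly (flatH)
open FlatPortDistanceL0 (levOf_domT)
open FlatPortHRows12 (cf_ne_zero)
open FlatPortHRows12L0 (hRows12_of_cor28Shape)
open FlatPortCor28PadAllL (cor28_kLevel_H_DH_pad_allL)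
open FlatPortKernelRowsL0 (unitWeights_pos globalBand_unitWeights)
open FlatPortColumnSumL0 (colSum_domT)

/-- `1 ≤ 3` (named once; every `domT`/`PV` below carries the same proof term). [folklore] -/
private theorem hd3 : 1 ≤ 2 + 1 := by norm_num

/-! ## §1 The dictionary line: the carrier block is constant on the block of a site index -/

section Dictionary

variable {ℓ m K : ℕ} {hL : Odd (ℓ + 1) ∧ 1 < ℓ + 1} {Mh k R : ℕ} {P' : Fin (2 + 1) → ℕ}
variable (hN : ∀ μ, N0 ℓ Mh k P' μ = (PV 2 ℓ m K hd3 hL).sitesPerDir 0) (D : TDomains 2 ℓ Mh k P' R) (hk : k ≤ m + K)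


end Dictionary

/-! ## §2 The kernel row (2.151)₁ and the transposed column sum at every charted family -/

/-- **ROW (k1) AND ITS TRANSPOSED COLUMN SUM AT EVERY CHARTED FAMILY OF THE d = 3 CARRIER, ODD `L ≥ 5`, `k ≥ 1`, CONSTANTS FROM `L` ALONE**: there are `M_h⁰, R₀` and
`C ≥ 0`, `r > 0`, `K₀ ≥ 0` such that for every volume exponent `m ≥ 1`, heights `1 ≤ K − n`, `K − n + 1 ≤ m + K`, every torus family with `P′ = L·P″`, `P″ ≥ 5`,
`M_h = Lᵃ ≥ M_h⁰`, `R ≥ R₀`, and every P2 weight family: (i) `|(flatH e_c)(b)| ≤ C·e^{−r(d_T(y(b), βc) + 3)}` ([Balaban1984PropagatorsII] Cor. 2.8 (2.151)₁ through package A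
`cor28_kLevel_H_DH_pad` ∘ `hRows12_of_cor28Shape`; `C = C₅e^{3δ₅}`, `r = δ₅`); (ii) `Σ_b (w₃ b)⁻¹·C·e^{−r(d_T(y(b), βc) + 3)} ≤ K₀·(L^{K−n})³` (`FlatPortColumnSumL0.colSum_domT`
at the same rate; `K₀ = 3C·K261`). [cite: Balaban1984PropagatorsII, Cor. 2.8 (2.150)-(2.151) p.249, Lemma 2.1 (2.61) p.234; Balaban1985Variational, (161)-(163) p.303] -/
theorem kernelRow1_colSum_domT_allL (ℓ : ℕ) (hL : Odd (ℓ + 1) ∧ 1 < ℓ + 1) :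
    ∃ (Mh₀ R₀ : ℕ) (C r K₀ : ℝ), 0 ≤ C ∧ 0 < r ∧ 0 ≤ K₀ ∧
    ∀ (m : ℕ) (hm : 1 ≤ m) (n K : ℕ) {Mh R : ℕ} {P' : Fin (2 + 1) → ℕ} (hN : ∀ μ, N0 ℓ Mh (K - n) P' μ = (PV 2 ℓ m K hd3 hL).sitesPerDir 0)
      (D : TDomains 2 ℓ Mh (K - n) P' R) (hk : K - n ≤ m + K) (_ : 1 ≤ K - n) (_ : K - n + 1 ≤ m + K)
      {P'' : Fin (2 + 1) → ℕ} (_ : ∀ μ, P' μ = (ℓ + 1) * P'' μ) (_ : ∀ μ, 5 ≤ P'' μ)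
      {a : ℕ} (_ : Mh = (ℓ + 1) ^ a) (_ : Mh₀ ≤ Mh) (_ : R₀ ≤ R)
      (w : ℕ → PBond (PV 2 ℓ m K hd3 hL) 0 → ℝ) (_ : IsLevWeight (⟨ℓ + 1, hL, m, hm⟩ : T3Family) n K (B6GlobalChartV1L0.domT hN D hk) w),
      (∀ (c : BondIdx (domT hN D hk)) (b : PBond (PV 2 ℓ m K hd3 hL) 0),
        |flatH (⟨ℓ + 1, hL, m, hm⟩ : T3Family) n K (domT hN D hk) (Pi.single c 1) b| ≤
          C * Real.exp (-(r * (((bondT D).dist (blkV1 hN D b) (β hN D hk c) : ℝ) + 3)))) ∧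
      ∀ c : BondIdx (domT hN D hk), ∑ b : PBond (PV 2 ℓ m K hd3 hL) 0,
          (w 3 b)⁻¹ * (C * Real.exp (-(r * (((bondT D).dist (blkV1 hN D b) (β hN D hk c) : ℝ) + 3)))) ≤
        K₀ * ((((ℓ + 1 : ℕ) : ℝ)) ^ (K - n)) ^ 3 := by
  -- package A at the unit band `b₀ = b₁ = 1`
  obtain ⟨σa, hσa, hA⟩ := cor28_kLevel_H_DH_pad_allL 2 ℓ hd3 hL one_pos (le_refl (1 : ℝ))
  obtain ⟨δ₅, C₅, M₂a, N₁a, hδ₅, hC₅, hM₂a, hrowsA⟩ := hA σa hσa le_rfl (1 / 2) (by norm_num) (by norm_num)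
  -- ONE Lemma-2.1 budget at rate `δ₅` (`α = 1`) for the transposed (2.61) column sum
  obtain ⟨hN₀pos, hθ⟩ := theta_budget ℓ (show 0 < 1 * δ₅ by linarith)
  set N₀ : ℕ := ⌈2 * ((2 + 1 : ℕ) : ℝ) * Real.log ((ℓ : ℝ) + 1) / (1 * δ₅)⌉₊ + 1 with hN₀
  -- the constants
  set Lr : ℝ := (ℓ : ℝ) + 1 with hLr
  have hL1 : (1 : ℝ) ≤ Lr := by rw [hLr]; linarith [(Nat.cast_nonneg ℓ : (0 : ℝ) ≤ ℓ)]
  set C : ℝ := C₅ * Real.exp (3 * δ₅) with hC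
  have hC0 : 0 ≤ C := by positivity
  set c61 : ℝ := K261 N₀ (2 + 1) Lr 1 (1 * δ₅) with hc61
  have hc610 : 0 ≤ c61 := K261_nonneg (by linarith : (0 : ℝ) ≤ Lr) zero_le_one
  -- the thresholds on `M_h` and `R`
  set Mh₀ : ℕ := max 8 ⌈M₂a⌉₊ with hMh₀
  set R₀ : ℕ := max (2 * (ℓ + 1) ^ 2) (max (N₁a + 1) (N₀ + 1)) with hR₀
  refine ⟨Mh₀, R₀, C, δ₅, C * (3 * c61), hC0, hδ₅, by positivity, ?_⟩
  intro m hm n K Mh R P' hN D hk hk1 hk' P'' hLP hP5 a hMha hMh hR w hw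
  -- unpack the thresholds
  have hM8 : 8 ≤ Mh := le_trans (le_max_left _ _) hMh
  have hMh1 : 1 ≤ Mh := le_trans (by norm_num) hM8
  have hR2 : 2 * (ℓ + 1) ^ 2 ≤ R := le_trans (le_max_left _ _) hR
  have hRLM : ∀ {N : ℕ}, N + 1 ≤ R₀ → N + 1 ≤ R * ((ℓ + 1) * Mh) := fun {N} h =>
    le_trans (le_trans h hR) (Nat.le_mul_of_pos_right R (Nat.mul_pos (Nat.succ_pos ℓ) (by omega)))
  have hN₁a : N₁a + 1 ≤ R * ((ℓ + 1) * Mh) := hRLM (le_trans (le_max_left _ _) (le_max_right _ _))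
  have hN₀' : N₀ + 1 ≤ R * ((ℓ + 1) * Mh) := hRLM (le_trans (le_max_right _ _) (le_max_right _ _))
  have hM₂a' : M₂a ≤ ((ℓ : ℝ) + 1) * Mh := by
    have h0 : ⌈M₂a⌉₊ ≤ Mh := le_trans (le_max_right _ _) hMh
    have h1 : M₂a ≤ (⌈M₂a⌉₊ : ℝ) := Nat.le_ceil _
    have h2 : (⌈M₂a⌉₊ : ℝ) ≤ (Mh : ℝ) := by exact_mod_cast h0
    have h3 : (Mh : ℝ) ≤ ((ℓ : ℝ) + 1) * Mh := le_mul_of_one_le_left (Nat.cast_nonneg _) hL1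
    linarith
  have hP1 : ∀ μ, 1 ≤ P' μ := fun μ => by rw [hLP μ]; exact Nat.mul_pos (Nat.succ_pos ℓ) (by have := hP5 μ; omega)
  -- the band weights
  set ws : BondIdx (domT hN D hk) → ℝ := fun i =>
    ((((ℓ + 1 : ℕ) : ℝ)) ^ (K - n) / (((ℓ + 1 : ℕ) : ℝ)) ^ (i.1.1 : ℕ)) ^ 2 * ((((ℓ + 1 : ℕ) : ℝ)) ^ (i.1.1 : ℕ)) ^ (2 + 1) with hws_def
  have hws : ∀ i, 0 < ws i := unitWeights_pos ℓ hL m n K hN D hk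
  have hband : GlobalBand (Dm := domT hN D hk) 1 1 ((((ℓ + 1 : ℕ) : ℝ)) ^ (K - n)) ws := globalBand_unitWeights ℓ hL m n K hN D hk
  -- the port rows of package A at these data
  obtain ⟨hH1, hH2⟩ := hrowsA m K hN D hk hk1 hk' hLP hP5 hMha hM8 hR2 hM₂a' hN₁a (cf_ne_zero ℓ n K) hws hband
  refine ⟨fun c b => ?_, fun c => ?_⟩
  · -- (k1) over `d_T + 3`
    have h := (hRows12_of_cor28Shape ℓ hL m hm n K hN D hk hws hH1 hH2 w hw c (Pi.single c 1) (Pi.single_eq_same c 1)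
      (fun c' hc' => Pi.single_eq_of_ne hc' 1) b).1
    exact h
  · -- the transposed column sum at rate `δ₅`
    have hcs := colSum_domT ℓ hL m hm n K hN D hk hMh1 hP1 hδ₅.le zero_le_one le_rfl hN₀pos hN₀' hθ w hw c
    have hw3 : ∀ b : PBond (PV 2 ℓ m K hd3 hL) 0, 0 ≤ (w 3 b)⁻¹ := fun b => by
      rw [hw 3 b]; positivity
    calc ∑ b : PBond (PV 2 ℓ m K hd3 hL) 0, (w 3 b)⁻¹ * (C * Real.exp (-(δ₅ * (((bondT D).dist (blkV1 hN D b) (β hN D hk c) : ℝ) + 3))))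
        = C * ∑ b : PBond (PV 2 ℓ m K hd3 hL) 0, (w 3 b)⁻¹ * Real.exp (-(1 * δ₅ * (((bondT D).dist (blkV1 hN D b) (β hN D hk c) : ℝ) + 3))) := by
          rw [Finset.mul_sum]
          exact Finset.sum_congr rfl fun b _ => by rw [one_mul]; ring
      _ ≤ C * (3 * ((((ℓ + 1 : ℕ) : ℝ)) ^ (K - n)) ^ 3 * K261 N₀ (2 + 1) ((ℓ : ℝ) + 1) 1 (1 * δ₅)) := mul_le_mul_of_nonneg_left hcs hC0
      _ = C * (3 * c61) * ((((ℓ + 1 : ℕ) : ℝ)) ^ (K - n)) ^ 3 := by rw [hc61, hLr]; ring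

/-! ## §3 The four inputs of `ChartHInv.column_letter` at every admissible family of the P2 text -/

open Summit.QuantumFields.YangMills.Theorems.FlatCubeOpsText (Adm22)

/-- ★★ **THE (X2-H) CONCRETE HALF — THE INPUTS `hks0`, `hK`, `hblk`, `hcol` OF `ChartHInv.column_letter` FOR THE CANONICAL `flatH` AT EVERY ADMISSIBLE FAMILY OF THE
P2 TEXT** (level `0` admitted; via `FlatPortChartL0.tdOfAdmL0`∕`domT_tdOfAdmL0`): for odd `L = ℓ + 1 ≥ 3` there are `M_h⁰, R₀` and `K₀ ≥ 0` such that for all `m ≥ 1`, heights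
`1 ≤ K − n`, `K − n + 1 ≤ m + K`, big blocks `M = L·M_h`, `M_h = L^{a′} ≥ M_h⁰`, `R ≥ R₀`, torus size `a′ + 3 ≤ m + n`, every `D : Domains (F.P K)` with `D.k = K − n`,
`Adm22 D R (L·M_h)`, and every P2 weight family `w`, there is a kernel majorant `k(x, c)` of the columns of `flatH` (`|(flatH e_c)(b)| ≤ k(b₋, c)`), nonnegative,
CONSTANT on the block of every site index, with the transposed column sum `Σ_b (w₃ b)⁻¹·k(b₋, c) ≤ K₀·η⁻³`, `η = L^{−(K−n)}` — the weight of record `u = η⁻³(Lʲη)⁻¹` of the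
(X2) chain is then read by `column_letter` (`h₁ = K₀(1 + θ(d+2)L(1+L³))(1 + 2d(d+2)L)`).
[cite: Balaban1984PropagatorsII, (2.1)-(2.4) p.224, Cor. 2.8 (2.150)-(2.151) p.249, Lemma 2.1 (2.61) p.234; Balaban1985Variational, (46) p.285, (88)-(90) pp.291-292, (161)-(163) p.303] -/
theorem columnInputs_of_adm22_allL (ℓ : ℕ) (hL : Odd (ℓ + 1) ∧ 1 < ℓ + 1) :
    ∃ (Mh₀ R₀ : ℕ) (K₀ : ℝ), 0 ≤ K₀ ∧
    ∀ (m : ℕ) (hm : 1 ≤ m) (n K : ℕ) (_ : 1 ≤ K - n) (_ : K - n + 1 ≤ m + K) {Mh R a' : ℕ} (_ : Mh = (ℓ + 1) ^ a') (_ : Mh₀ ≤ Mh) (_ : R₀ ≤ R) (_ : a' + 3 ≤ m + n)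
      (D : B6SectADomainsV1.Domains (PV 2 ℓ m K hd3 hL)) (_ : D.k = K - n) (_ : FlatCubeOpsText.Adm22 D R ((ℓ + 1) * Mh))
      (w : ℕ → PBond (PV 2 ℓ m K hd3 hL) 0 → ℝ) (_ : IsLevWeight (⟨ℓ + 1, hL, m, hm⟩ : T3Family) n K D w),
      ∃ ks : Site (PV 2 ℓ m K hd3 hL) 0 → BondIdx D → ℝ,
        (∀ x c, 0 ≤ ks x c) ∧
        (∀ (c : BondIdx D) (b : PBond (PV 2 ℓ m K hd3 hL) 0), |flatH (⟨ℓ + 1, hL, m, hm⟩ : T3Family) n K D (Pi.single c 1) b| ≤ ks b.src c) ∧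
        (∀ (c : BondIdx D) (s : SiteIdx D) (x x' : Site (PV 2 ℓ m K hd3 hL) 0), iterBlockOf (s.1.1 : ℕ) x = s.1.2 → iterBlockOf (s.1.1 : ℕ) x' = s.1.2 →
          ks x c = ks x' c) ∧
        ∀ c : BondIdx D, ∑ b : PBond (PV 2 ℓ m K hd3 hL) 0, (w 3 b)⁻¹ * ks b.src c ≤
          K₀ * (((((ℓ + 1 : ℕ) : ℝ))⁻¹) ^ (K - n))⁻¹ ^ 3 := by
  obtain ⟨Mh₀, R₀, C, r, K₀, hC, hr, hK₀, hmain⟩ := kernelRow1_colSum_domT_allL ℓ hL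
  refine ⟨Mh₀, R₀, K₀, hK₀, ?_⟩
  intro m hm n K hk1 hk' Mh R a' hMha hMh hR hsize D hDk hAdm w hw
  have hk : K - n ≤ m + K := by omega
  obtain ⟨hN, hLP, hP5⟩ := chart_params_allL ℓ m n K a' hL hk1 hsize
  rw [hMha] at hAdm
  have hN' : ∀ μ : Fin (2 + 1), N0 ℓ Mh (K - n) (fun _ => 2 * (ℓ + 1) ^ (m + n - 1 - a')) μ = (PV 2 ℓ m K hd3 hL).sitesPerDir 0 := by
    rw [hMha]; exact hN
  rw [← hMha] at hAdm
  set D' := FlatPortChartL0.tdOfAdmL0 hN' D hDk hk hAdm with hD'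
  have hEq : domT hN' D' hk = D := FlatPortChartL0.domT_tdOfAdmL0 hN' D hDk hk hAdm
  rw [← hEq] at hw ⊢
  obtain ⟨hK1, hcol⟩ := hmain m hm n K hN' D' hk hk1 hk' hLP hP5 hMha hMh hR w hw
  refine ⟨fun x c => C * Real.exp (-(r * (((bondT D').dist (blkOf D'.toDomains (toBox hN' x)) (β hN' D' hk c) : ℝ) + 3))),
    fun x c => by positivity, fun c b => hK1 c b, fun c s x x' hx hx' => ?_, fun c => ?_⟩
  · beta_reduce
    rw [blkOf_toBox_eq_of_block hN' D' hk s x x' hx hx']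
  · have hinv : (((((ℓ + 1 : ℕ) : ℝ))⁻¹) ^ (K - n))⁻¹ = (((ℓ + 1 : ℕ) : ℝ)) ^ (K - n) := by rw [inv_pow, inv_inv]
    rw [hinv]
    exact hcol c

/-! ## §4 The column letter of the canonical `flatH` itself — THE (X2-H) LETTER OF RECORD under the re-based chart (★★OWNER RULING g26-№6 (S5): `H := flatH`, no `dφ`) -/



/-- ★★ **THE (X2-H) LETTER OF RECORD: THE COLUMN LETTER OF THE CANONICAL `flatH` (and of its kernel extension to vector data) AT EVERY ADMISSIBLE FAMILY OF THE P2 TEXT**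
(the binders of `columnInputs_of_adm22_allL` ∕ `kernelRowsAt_of_adm22`): `∀ X, Σ_b (w₃ b)⁻¹·|(flatH X)(b)| ≤ K₀·η⁻³·Σ_c |X(c)|` and, for every `HM` with `HM X b = Σ_c (flatH e_c)(b)•X c`,
`Σ_b (w₃ b)⁻¹·‖(HM X)(b)‖ ≤ K₀·η⁻³·Σ_c ‖X(c)‖`, `η = L^{−(K−n)}` — (2.151)₁ + the transposed (2.61) column sum, by linearity; constants from `L` alone.  The `ℓ¹`-dual of
«`flatHᵀ` maps `(Lʲη)³`-weighted currents to `η³`-bounded index functions» (weight `u ≡ η⁻³`; the weight of record `η⁻³(Lʲη)⁻¹ ≥ η⁻³` follows a fortiori since `Lʲη ≤ 1`).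
[cite: Balaban1984PropagatorsII, Cor. 2.8 (2.150)-(2.151) p.249, Lemma 2.1 (2.61) p.234; Balaban1985Variational, (46) p.285, (88)-(90) pp.291-292, (161)-(163) p.303] -/
theorem flatH_column_of_adm22_allL (ℓ : ℕ) (hL : Odd (ℓ + 1) ∧ 1 < ℓ + 1) :
    ∃ (Mh₀ R₀ : ℕ) (K₀ : ℝ), 0 ≤ K₀ ∧
    ∀ (m : ℕ) (hm : 1 ≤ m) (n K : ℕ) (_ : 1 ≤ K - n) (_ : K - n + 1 ≤ m + K) {Mh R a' : ℕ} (_ : Mh = (ℓ + 1) ^ a') (_ : Mh₀ ≤ Mh) (_ : R₀ ≤ R) (_ : a' + 3 ≤ m + n)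
      (D : B6SectADomainsV1.Domains (PV 2 ℓ m K hd3 hL)) (_ : D.k = K - n) (_ : FlatCubeOpsText.Adm22 D R ((ℓ + 1) * Mh))
      (w : ℕ → PBond (PV 2 ℓ m K hd3 hL) 0 → ℝ) (_ : IsLevWeight (⟨ℓ + 1, hL, m, hm⟩ : T3Family) n K D w),
      (∀ X : BondIdx D → ℝ, ∑ b : PBond (PV 2 ℓ m K hd3 hL) 0, (w 3 b)⁻¹ * |flatH (⟨ℓ + 1, hL, m, hm⟩ : T3Family) n K D X b| ≤
        K₀ * (((((ℓ + 1 : ℕ) : ℝ))⁻¹) ^ (K - n))⁻¹ ^ 3 * ∑ c, |X c|) ∧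
      ∀ {V : Type} [NormedAddCommGroup V] [NormedSpace ℝ V] (HM : (BondIdx D → V) → (PBond (PV 2 ℓ m K hd3 hL) 0 → V)),
        (∀ X b, HM X b = ∑ c : BondIdx D, flatH (⟨ℓ + 1, hL, m, hm⟩ : T3Family) n K D (Pi.single c 1) b • X c) →
        ∀ X : BondIdx D → V, ∑ b : PBond (PV 2 ℓ m K hd3 hL) 0, (w 3 b)⁻¹ * ‖HM X b‖ ≤
          K₀ * (((((ℓ + 1 : ℕ) : ℝ))⁻¹) ^ (K - n))⁻¹ ^ 3 * ∑ c, ‖X c‖ := by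
  obtain ⟨Mh₀, R₀, K₀, hK₀, hmain⟩ := columnInputs_of_adm22_allL ℓ hL
  refine ⟨Mh₀, R₀, K₀, hK₀, ?_⟩
  intro m hm n K hk1 hk' Mh R a' hMha hMh hR hsize D hDk hAdm w hw
  obtain ⟨ks, -, hK, -, hcol⟩ := hmain m hm n K hk1 hk' hMha hMh hR hsize D hDk hAdm w hw
  have hw3 : ∀ b : PBond (PV 2 ℓ m K hd3 hL) 0, 0 ≤ (w 3 b)⁻¹ := fun b => by rw [hw 3 b]; positivity
  refine ⟨fun X => ?_, ?_⟩
  · exact l1_column_of_kernel (ι := BondIdx D) (κ := PBond (PV 2 ℓ m K hd3 hL) 0) (flatH (⟨ℓ + 1, hL, m, hm⟩ : T3Family) n K D)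
      (fun b => (w 3 b)⁻¹) hw3 (fun b c => ks b.src c) hK hcol X
  · intro V _ _ HM hHM X
    exact smul_column_of_kernel (ι := BondIdx D) (κ := PBond (PV 2 ℓ m K hd3 hL) 0) (flatH (⟨ℓ + 1, hL, m, hm⟩ : T3Family) n K D) HM hHM
      (fun b => (w 3 b)⁻¹) hw3 (fun b c => ks b.src c) hK hcol X

/-! ## §5 The letter at the WEIGHT OF RECORD for the level-scaled extension `Hs` (RULING g26-№11 (i): the `H` of the ♭ chart) -/

/-- ★★ **THE (X2-H) LETTER FOR THE `H` OF RECORD `Hs X b = Σ_c (flatH e_c)(b)•((L^{j(c)}η)⁻¹•X c)`** (print's `H` of (45) «`LʲηQ_jHB = B`»; ★w3-19200 g4's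
`…FlatHScaledExtension` inhabitant): at every admissible family of the P2 text, for every such `Hs` on `V`-valued index data,
`Σ_b (w₃ b)⁻¹·‖(Hs X)(b)‖ ≤ K₀·Σ_c η⁻³(L^{j(c)}η)⁻¹·‖X(c)‖` — EXACTLY the weight of record `u(j,c) = η⁻³(Lʲη)⁻¹` of the (X2) chain (`flatH_column_of_adm22_allL` at the scaled data).
[cite: Balaban1984PropagatorsII, Cor. 2.8 (2.150)-(2.151) p.249, Lemma 2.1 (2.61) p.234; Balaban1985Variational, (45)-(46) p.285, (88)-(90) pp.291-292, (161)-(163) p.303] -/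
theorem flatHs_column_of_adm22_allL (ℓ : ℕ) (hL : Odd (ℓ + 1) ∧ 1 < ℓ + 1) :
    ∃ (Mh₀ R₀ : ℕ) (K₀ : ℝ), 0 ≤ K₀ ∧
    ∀ (m : ℕ) (hm : 1 ≤ m) (n K : ℕ) (_ : 1 ≤ K - n) (_ : K - n + 1 ≤ m + K) {Mh R a' : ℕ} (_ : Mh = (ℓ + 1) ^ a') (_ : Mh₀ ≤ Mh) (_ : R₀ ≤ R) (_ : a' + 3 ≤ m + n)
      (D : B6SectADomainsV1.Domains (PV 2 ℓ m K hd3 hL)) (_ : D.k = K - n) (_ : FlatCubeOpsText.Adm22 D R ((ℓ + 1) * Mh))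
      (w : ℕ → PBond (PV 2 ℓ m K hd3 hL) 0 → ℝ) (_ : IsLevWeight (⟨ℓ + 1, hL, m, hm⟩ : T3Family) n K D w)
      {V : Type} [NormedAddCommGroup V] [NormedSpace ℝ V] (Hs : (BondIdx D → V) → (PBond (PV 2 ℓ m K hd3 hL) 0 → V)),
      (∀ X b, Hs X b = ∑ c : BondIdx D, flatH (⟨ℓ + 1, hL, m, hm⟩ : T3Family) n K D (Pi.single c 1) b •
        (((((ℓ + 1 : ℕ) : ℝ)) ^ (c.1.1 : ℕ) * ((((ℓ + 1 : ℕ) : ℝ))⁻¹) ^ (K - n))⁻¹ • X c)) →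
      ∀ X : BondIdx D → V, ∑ b : PBond (PV 2 ℓ m K hd3 hL) 0, (w 3 b)⁻¹ * ‖Hs X b‖ ≤
        K₀ * ∑ c : BondIdx D, ((((((ℓ + 1 : ℕ) : ℝ))⁻¹) ^ (K - n))⁻¹ ^ 3 *
          ((((ℓ + 1 : ℕ) : ℝ)) ^ (c.1.1 : ℕ) * ((((ℓ + 1 : ℕ) : ℝ))⁻¹) ^ (K - n))⁻¹) * ‖X c‖ := by
  obtain ⟨Mh₀, R₀, K₀, hK₀, hmain⟩ := flatH_column_of_adm22_allL ℓ hL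
  refine ⟨Mh₀, R₀, K₀, hK₀, ?_⟩
  intro m hm n K hk1 hk' Mh R a' hMha hMh hR hsize D hDk hAdm w hw V _ _ Hs hHs X
  have hL0 : (0 : ℝ) < ((ℓ + 1 : ℕ) : ℝ) := by exact_mod_cast Nat.succ_pos ℓ
  -- the level scale factor and the scaled data
  set s : BondIdx D → ℝ := fun c => ((((ℓ + 1 : ℕ) : ℝ)) ^ (c.1.1 : ℕ) * ((((ℓ + 1 : ℕ) : ℝ))⁻¹) ^ (K - n))⁻¹ with hs
  have hs0 : ∀ c, 0 < s c := fun c => by rw [hs]; positivity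
  set X' : BondIdx D → V := fun c => s c • X c with hX'
  -- `Hs` read as the plain kernel extension `HM` of the UNSCALING of its data
  set HM : (BondIdx D → V) → (PBond (PV 2 ℓ m K hd3 hL) 0 → V) := fun Z => Hs (fun c => (s c)⁻¹ • Z c) with hHM
  have hHM' : ∀ Z b, HM Z b = ∑ c : BondIdx D, flatH (⟨ℓ + 1, hL, m, hm⟩ : T3Family) n K D (Pi.single c 1) b • Z c := by
    intro Z b
    simp only [hHM]
    rw [hHs]
    refine Finset.sum_congr rfl fun c _ => ?_
    show flatH (⟨ℓ + 1, hL, m, hm⟩ : T3Family) n K D (Pi.single c 1) b • (s c • ((s c)⁻¹ • Z c)) = _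
    rw [smul_smul (s c), mul_inv_cancel₀ (hs0 c).ne', one_smul]
  have hHsX : ∀ b, Hs X b = HM X' b := by
    intro b
    simp only [hHM, hX']
    congr 1
    funext c
    show X c = (s c)⁻¹ • (s c • X c)
    rw [smul_smul ((s c)⁻¹), inv_mul_cancel₀ (hs0 c).ne', one_smul]
  have hmainHM := (hmain m hm n K hk1 hk' hMha hMh hR hsize D hDk hAdm w hw).2 HM hHM' X'
  calc ∑ b : PBond (PV 2 ℓ m K hd3 hL) 0, (w 3 b)⁻¹ * ‖Hs X b‖
      = ∑ b : PBond (PV 2 ℓ m K hd3 hL) 0, (w 3 b)⁻¹ * ‖HM X' b‖ := Finset.sum_congr rfl fun b _ => by rw [hHsX b]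
    _ ≤ K₀ * (((((ℓ + 1 : ℕ) : ℝ))⁻¹) ^ (K - n))⁻¹ ^ 3 * ∑ c, ‖X' c‖ := hmainHM
    _ = K₀ * ∑ c : BondIdx D, ((((((ℓ + 1 : ℕ) : ℝ))⁻¹) ^ (K - n))⁻¹ ^ 3 * s c) * ‖X c‖ := by
        rw [mul_assoc, Finset.mul_sum]
        refine congrArg (K₀ * ·) (Finset.sum_congr rfl fun c _ => ?_)
        rw [hX', norm_smul, Real.norm_eq_abs, abs_of_pos (hs0 c)]
        ring

end Summit.QuantumFields.YangMills.Theorems.FlatPortColumnLetterAllL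

end
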